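import Summits.HodgeConjecture.HodgeConjecture.Theorems.F0P3cIwahoriDatumU2Alg     -- ★ (LH6-p05 (g2)) ANY-RANK Iwahori algebra: `coe_level_eq_mul`, `nbar_torus_unipotent_inj`, `coe_weylConj_apply`, `weylLongU_inv_eq`, `weylConj_mem_level`
import Literature.NumberTheory.Automorphic.UnitaryGroupLineUnipotentRing            -- ★ LineRing (F0P3b-p01): the rank-2 chart `u ↦ u₀₁ ∈ R⁻` — `umat_shape_two`, `umat_mul_zero_one_two`, `umat_inv_zero_one_two`, `ext_two`, `mul_comm_two`
import HarnessLib

/-!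
# F0 · P3c · ROAD «UP-TR» ∕ «JAC-LOC₂» brick (S2) «LEVELS₂»: the levels `K_δ ∩ U(σ, Φ_N)(K)` as an Iwahori BIJECTION at ANY rank, and the rank-2 line boxes

Cell `pub/hodgecm-mathlib`, crux H413 = `stmt-HodgeConjecture-24833` (lane `--supports … --as helper`), route HCCMUnconditional; seat LH4-p03 (g9) (free hand on ROAD «UP-TR»,
holder F0P3-p02 (g23); sub-road «JAC-LOC₂» = CENSUS (H4s) v2 of LH7-p02 (g8), 2026-09-02 18:32:29Z, file (S2) `…UpTrU2Levels`).  THEOREMS ONLY (no `def`, no instance, no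
notation, no named fact, no `sorry`); ★-only imports.  The rank-2 twin — and, where the proofs are rank-free, the ANY-RANK generalisation — of ★ (J2)
`F0P3cStCharTSLevelBoxes` §2–§4 (F0P3-p02 (g21)), written OVER the ★ any-rank Iwahori algebra `F0P3cIwahoriDatumU2Alg` (cited, not re-typed) and the ★ rank-2 line chart
`UnitaryGroupLineUnipotentRing` (`N₂ ≅ K⁻`, abelian).
HONEST LABEL: HC_CM is proved only modulo the 7 printed citations (2 remaining: hLiu418 = `stmt-HodgeConjecture-24832`, h413 = `stmt-HodgeConjecture-24833`) until rung 0 closes;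
count-neutral (one brick of the hyperbolic `H`-Jacobian of the in-house `hUpTr` road; pays no organ).

SETTING.  `K` a field with a `ValuativeRel`, `σ : K →+* K`, `J = Φ_N = (StdForm.antidiagonal N).over K`, `U = unitaryGroupOfForm σ J`, `N = (borelTriple σ J hJ).N = unipotentU σ J`,
`T = (borelTriple σ J hJ).M = torusU σ J` (both `rfl`, ★ `borelTriple_N ∕ _M`), `w₀ = weylLongU σ hJ`, `N̄ = N.map (conj w₀)`, levels `K_δ := (congruenceGL N δ).comap U.subtype`.
§1 (any rank `N`): (L3) `mem_level_iff_of_eq_glDiagonal` — `diag(d) ∈ K_δ ↔ ∀ i, v(dᵢ − 1) ≤ δ` (`δ < 1`); (L2) `mem_level_inf_Nbar_iff` — `K_δ ∩ N̄ = w₀ (K_δ ∩ N) w₀`;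
`apply_diag_eq_one_of_mem_Nbar`; `injOn_nbar_torus_unipotent` — uniqueness of ALL THREE factors in `N̄ · T · N` (★ `nbar_torus_unipotent_inj` gives the `N`-factor; the diagonal
of `n̄ m` is that of `m`); (L4) **`bijOn_iwahori_level`** — `(n̄, m, n) ↦ n̄ m n` is a bijection `(K_δ ∩ N̄) × (K_δ ∩ T) × (K_δ ∩ N) → K_δ` for `δ < 1` (onto by ★ `coe_level_eq_mul`),
`existsUnique_iwahori_level`, `mem_level_of_nbar_torus_unipotent_mem`.
§2 (rank 2, the line chart `u ↦ u₀₁`): (L1)₂ **`mem_level_iff_of_mem_unipotentU_two`** — `u ∈ K_δ ↔ v(u₀₁) ≤ δ` (`δ < 1`; no `v(½)` side condition: `N₂` has no Heisenberg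
coordinate); (L6)₂ `exists_subgroup_lineBox` — the line box `{u ∣ v(u₀₁) ≤ ρ}` is a subgroup of `N₂` for EVERY radius (abelian chart, ultrametric inequality), over a generic valued
ring as ★ (J2) §4.
§3: the line boxes `N[ρ]`, `N̄[ρ] = w₀N[ρ]w₀` and the level pieces `K_δ ∩ N`, `K_δ ∩ T` as `Subgroup`s of the ambient `U′` with their carriers spelled out (★ (J2)-sequel
`F0P3cStCharTSLevelBoxSubgroups` one rank down) — the shape the sandwich ∕ index ∕ orbit-tube bricks (S4) consume.

## References
* [Casselman1995] W. Casselman, *Introduction to the theory of admissible representations of `p`-adic reductive groups* (1995), Prop. 1.4.4.  [BruhatTits1972] F. Bruhat, J. Tits,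
  Publ. Math. IHÉS 41 (1972), (4.4.3)–(4.4.4).  [vanDijk1972] G. van Dijk, Math. Ann. 199 (1972), §2.  [Rogawski1990] J. D. Rogawski, Ann. of Math. Stud. 123 (1990), §1.10 p. 9; §12.5 p. 182.
-/
set_option autoImplicit false
-- the mandated namespace has the single-problem summit's repeated segment (`HodgeConjecture.HodgeConjecture`)
set_option linter.dupNamespace false
noncomputable section

open Matrix ValuativeRel
open scoped MatrixGroups
open Literature.NumberTheory.Automorphic Literature.NumberTheory.Automorphic.UnitaryGroup Literature.NumberTheory.Automorphic.UnitaryGroup.LineRing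
open Summit.HodgeConjecture.HodgeConjecture.Cruxes.H413.F0P3cIwahoriDatumU2

namespace Summit.HodgeConjecture.HodgeConjecture.Cruxes.H413.F0P3cStCharTSUpTrU2Levels

/-! ## §1 Levels and the Iwahori bijection at ANY rank `N` -/

section AnyRank

variable {K : Type*} [Field K] [ValuativeRel K] (σ : K →+* K) {N : ℕ} {J : Matrix (Fin N) (Fin N) K} (hJ : J = (StdForm.antidiagonal N).over K)

/-- **(L3, any rank) `K_δ ∩ T` IS THE BOX `{diag(d) : v(dᵢ − 1) ≤ δ}`** (`δ < 1`; then `v(dᵢ) = 1` and `v(dᵢ⁻¹ − 1) = v(dᵢ − 1)`) — ★ (J2) `mem_level_iff_of_eq_glDiagonal` with `3 ↦ N`.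
[cite: Casselman1995, Prop. 1.4.4] -/
theorem mem_level_iff_of_eq_glDiagonal {δ : ValueGroupWithZero K} (hδ : δ < 1) {t : ↥(unitaryGroupOfForm σ J)} {d : Fin N → Kˣ}
    (hd : glDiagonal N K d = (t : GL (Fin N) K)) :
    t ∈ (congruenceGL N δ).comap (unitaryGroupOfForm σ J).subtype ↔ ∀ i, valuation K ((d i : K) - 1) ≤ δ := by
  rw [Subgroup.mem_comap, Subgroup.coe_subtype]
  constructor
  · intro h i
    obtain ⟨-, h2, -⟩ := mem_congruenceGL_iff.1 h
    have := h2 i i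
    rwa [← hd, coe_glDiagonal, Matrix.sub_apply, Matrix.diagonal_apply_eq, Matrix.one_apply_eq] at this
  · intro h
    rw [← hd]
    have hone : ∀ i, valuation K (d i : K) = 1 := fun i => by
      have h' : (d i : K) = 1 + ((d i : K) - 1) := by ring
      rw [h', Valuation.map_add_eq_of_lt_left] <;> rw [Valuation.map_one]
      exact lt_of_le_of_lt (h i) hδ
    have hinv : ∀ i, valuation K ((d i : K)⁻¹ - 1) ≤ δ := fun i => by
      have h' : ((d i : K))⁻¹ - 1 = (d i : K)⁻¹ * (1 - (d i : K)) := by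
        rw [mul_sub, mul_one, inv_mul_cancel₀ (d i).ne_zero]
      rw [h', Valuation.map_mul, map_inv₀, hone i, inv_one, one_mul, Valuation.map_sub_swap]
      exact h i
    refine mem_congruenceGL_iff.2 ⟨⟨fun i j => ?_, fun i j => ?_⟩, fun i j => ?_, fun i j => ?_⟩
    · rw [coe_glDiagonal, Matrix.diagonal_apply]
      split_ifs
      · rw [hone]
      · rw [Valuation.map_zero]; exact zero_le
    · rw [← map_inv, coe_glDiagonal, Matrix.diagonal_apply]
      split_ifs
      · rw [Pi.inv_apply, Units.val_inv_eq_inv_val, map_inv₀, hone, inv_one]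
      · rw [Valuation.map_zero]; exact zero_le
    · rw [coe_glDiagonal, Matrix.sub_apply, Matrix.diagonal_apply, Matrix.one_apply]
      split_ifs
      · exact h i
      · rw [sub_zero, Valuation.map_zero]; exact zero_le
    · rw [← map_inv, coe_glDiagonal, Matrix.sub_apply, Matrix.diagonal_apply, Matrix.one_apply]
      split_ifs
      · rw [Pi.inv_apply, Units.val_inv_eq_inv_val]; exact hinv i
      · rw [sub_zero, Valuation.map_zero]; exact zero_le

/-- **(L2, any rank) `K_δ ∩ N̄ = w₀ (K_δ ∩ N) w₀`**: an element of `K_δ ∩ w₀Nw₀` is `w₀ n w₀` with `n ∈ K_δ ∩ N` and conversely (`w₀⁻¹ = w₀` ★ `weylLongU_inv_eq`, `w₀` normalises every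
level ★ `weylConj_mem_level`) — ★ (J2) `mem_level_inf_Nbar_iff` with `3 ↦ N`. [cite: Casselman1995, Prop. 1.4.4] [cite: Rogawski1990, §1.10 p. 9] -/
theorem mem_level_inf_Nbar_iff {δ : ValueGroupWithZero K} (x : ↥(unitaryGroupOfForm σ J)) :
    x ∈ (congruenceGL N δ).comap (unitaryGroupOfForm σ J).subtype ⊓ ((borelTriple σ J hJ).N).map (MulAut.conj (weylLongU σ hJ)).toMonoidHom ↔
      ∃ n : ↥(unitaryGroupOfForm σ J), n ∈ (congruenceGL N δ).comap (unitaryGroupOfForm σ J).subtype ⊓ (borelTriple σ J hJ).N ∧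
        x = weylLongU σ hJ * n * weylLongU σ hJ := by
  have hwinv : (weylLongU σ hJ)⁻¹ = weylLongU σ hJ := weylLongU_inv_eq σ hJ
  have hw1 : weylLongU σ hJ * weylLongU σ hJ = 1 := mul_eq_one_iff_eq_inv.2 hwinv.symm
  constructor
  · rintro ⟨hxK, hxN⟩
    obtain ⟨n, hn, hnx⟩ := Subgroup.mem_map.1 hxN
    have hnx' : x = weylLongU σ hJ * n * weylLongU σ hJ := by rw [← hnx, MulEquiv.coe_toMonoidHom, MulAut.conj_apply, hwinv]
    refine ⟨n, Subgroup.mem_inf.2 ⟨?_, hn⟩, hnx'⟩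
    have : n = weylLongU σ hJ * x * weylLongU σ hJ := by
      rw [hnx']
      simp only [← mul_assoc, hw1, one_mul]
      rw [mul_assoc, hw1, mul_one]
    rw [this]
    exact weylConj_mem_level σ hJ hxK
  · rintro ⟨n, hn, rfl⟩
    obtain ⟨hnK, hnN⟩ := Subgroup.mem_inf.1 hn
    refine Subgroup.mem_inf.2 ⟨weylConj_mem_level σ hJ hnK, Subgroup.mem_map.2 ⟨n, hnN, ?_⟩⟩
    rw [MulEquiv.coe_toMonoidHom, MulAut.conj_apply, hwinv]

omit [ValuativeRel K] in
/-- The matrix of an element of `N̄ = w₀ N w₀` has unit diagonal (any rank; ★ `coe_weylConj_apply`). [cite: Rogawski1990, §1.10 p. 9] -/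
theorem apply_diag_eq_one_of_mem_Nbar {x : ↥(unitaryGroupOfForm σ J)}
    (hx : x ∈ ((borelTriple σ J hJ).N).map (MulAut.conj (weylLongU σ hJ)).toMonoidHom) (i : Fin N) :
    (((x : ↥(unitaryGroupOfForm σ J)) : GL (Fin N) K) : Matrix (Fin N) (Fin N) K) i i = 1 := by
  obtain ⟨n, hn, hnx⟩ := Subgroup.mem_map.1 hx
  have hwinv : (weylLongU σ hJ)⁻¹ = weylLongU σ hJ := weylLongU_inv_eq σ hJ
  have hnx' : x = weylLongU σ hJ * n * weylLongU σ hJ := by rw [← hnx, MulEquiv.coe_toMonoidHom, MulAut.conj_apply, hwinv]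
  rw [borelTriple_N] at hn
  rw [hnx', coe_weylConj_apply]
  exact ((mem_unipotentU_iff n).1 hn).2 _

omit [ValuativeRel K] in
/-- **The multiplication `N̄ × T × N → U` is INJECTIVE** (any rank; uniqueness of ALL THREE factors in `N̄ · T · N`, with no level condition): ★ any-rank `nbar_torus_unipotent_inj`
gives the `N`-factor; then the diagonal of the unit-lower-triangular-times-diagonal product `n̄ m` is that of `m`.  (The rank-3 three-factor form is ★ (J2) `nbar_torus_unipotent_unique`.)
[cite: Casselman1995, Prop. 1.4.4] [cite: BruhatTits1972, (4.4.4)] -/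
theorem injOn_nbar_torus_unipotent :
    Set.InjOn (fun p : ↥(unitaryGroupOfForm σ J) × (↥(unitaryGroupOfForm σ J) × ↥(unitaryGroupOfForm σ J)) => p.1 * p.2.1 * p.2.2)
      (((((borelTriple σ J hJ).N).map (MulAut.conj (weylLongU σ hJ)).toMonoidHom : Subgroup ↥(unitaryGroupOfForm σ J)) : Set ↥(unitaryGroupOfForm σ J)) ×ˢ
        ((((borelTriple σ J hJ).M : Subgroup ↥(unitaryGroupOfForm σ J)) : Set ↥(unitaryGroupOfForm σ J)) ×ˢ
          (((borelTriple σ J hJ).N : Subgroup ↥(unitaryGroupOfForm σ J)) : Set ↥(unitaryGroupOfForm σ J)))) := by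
  rintro ⟨nb, m, n⟩ ⟨hnb, hm, hn⟩ ⟨nb', m', n'⟩ ⟨hnb', hm', hn'⟩ h
  simp only [SetLike.mem_coe] at hnb hm hn hnb' hm' hn'
  change nb * m * n = nb' * m' * n' at h
  have hnn : n = n' := nbar_torus_unipotent_inj σ hJ nb hnb m hm n hn nb' hnb' m' hm' n' hn' h
  subst hnn
  have h2 : nb * m = nb' * m' := mul_right_cancel h
  obtain ⟨d, hd⟩ := (mem_torusU_iff m).1 hm
  obtain ⟨d', hd'⟩ := (mem_torusU_iff m').1 hm'
  have hdiag : ∀ (x mm : ↥(unitaryGroupOfForm σ J)) (e : Fin N → Kˣ), x ∈ ((borelTriple σ J hJ).N).map (MulAut.conj (weylLongU σ hJ)).toMonoidHom →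
      glDiagonal N K e = (mm : GL (Fin N) K) → ∀ i, (((x * mm : ↥(unitaryGroupOfForm σ J)) : GL (Fin N) K) : Matrix (Fin N) (Fin N) K) i i = e i := by
    intro x mm e hx he i
    rw [Subgroup.coe_mul, Units.val_mul, ← he, coe_glDiagonal, Matrix.mul_diagonal, apply_diag_eq_one_of_mem_Nbar σ hJ hx, one_mul]
  have hdd : d = d' := by
    funext i
    apply Units.ext
    rw [← hdiag nb m d hnb hd i, ← hdiag nb' m' d' hnb' hd' i, h2]
  have hmm : m = m' := by
    apply Subtype.ext
    rw [← hd, ← hd', hdd]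
  subst hmm
  have h1 : nb = nb' := mul_right_cancel h2
  subst h1
  rfl

/-- **(L4, any rank) THE IWAHORI FACTORISATION OF `K_δ ∩ U` IS A BIJECTION** `(K_δ ∩ N̄) × (K_δ ∩ T) × (K_δ ∩ N) → K_δ`, `(n̄, m, n) ↦ n̄ m n` (`δ < 1`): onto by ★ any-rank
`coe_level_eq_mul`, one-to-one by `nbar_torus_unipotent_unique` — ★ (J2) `bijOn_iwahori_level`, `3 ↦ N`. [cite: Casselman1995, Prop. 1.4.4] [cite: BruhatTits1972, (4.4.3)–(4.4.4)] -/
theorem bijOn_iwahori_level {δ : ValueGroupWithZero K} (hδ : δ < 1) :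
    Set.BijOn (fun p : ↥(unitaryGroupOfForm σ J) × (↥(unitaryGroupOfForm σ J) × ↥(unitaryGroupOfForm σ J)) => p.1 * p.2.1 * p.2.2)
      ((((congruenceGL N δ).comap (unitaryGroupOfForm σ J).subtype ⊓
            ((borelTriple σ J hJ).N).map (MulAut.conj (weylLongU σ hJ)).toMonoidHom : Subgroup ↥(unitaryGroupOfForm σ J)) :
          Set ↥(unitaryGroupOfForm σ J)) ×ˢ
        ((((congruenceGL N δ).comap (unitaryGroupOfForm σ J).subtype ⊓ (borelTriple σ J hJ).M : Subgroup ↥(unitaryGroupOfForm σ J)) :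
            Set ↥(unitaryGroupOfForm σ J)) ×ˢ
          (((congruenceGL N δ).comap (unitaryGroupOfForm σ J).subtype ⊓ (borelTriple σ J hJ).N : Subgroup ↥(unitaryGroupOfForm σ J)) :
            Set ↥(unitaryGroupOfForm σ J))))
      (((congruenceGL N δ).comap (unitaryGroupOfForm σ J).subtype : Subgroup ↥(unitaryGroupOfForm σ J)) : Set ↥(unitaryGroupOfForm σ J)) := by
  refine ⟨?_, ?_, ?_⟩
  · rintro ⟨x, y, z⟩ ⟨hx, hy, hz⟩
    exact Subgroup.mul_mem _ (Subgroup.mul_mem _ (Subgroup.mem_inf.1 hx).1 (Subgroup.mem_inf.1 hy).1) (Subgroup.mem_inf.1 hz).1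
  · rintro ⟨x, y, z⟩ ⟨hx, hy, hz⟩ ⟨x', y', z'⟩ ⟨hx', hy', hz'⟩ h
    exact injOn_nbar_torus_unipotent σ hJ ⟨(Subgroup.mem_inf.1 hx).2, (Subgroup.mem_inf.1 hy).2, (Subgroup.mem_inf.1 hz).2⟩
      ⟨(Subgroup.mem_inf.1 hx').2, (Subgroup.mem_inf.1 hy').2, (Subgroup.mem_inf.1 hz').2⟩ h
  · intro k hk
    have hk' := hk
    rw [coe_level_eq_mul σ hJ hδ] at hk'
    obtain ⟨_, ⟨x, hx, y, hy, rfl⟩, z, hz, rfl⟩ := hk'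
    exact ⟨(x, y, z), ⟨hx, hy, hz⟩, rfl⟩

/-- **(L4), `∃!`-form** (any rank): every `k ∈ K_δ` (`δ < 1`) is `n̄ m n` for a UNIQUE triple `(n̄, m, n) ∈ (K_δ ∩ N̄) × (K_δ ∩ T) × (K_δ ∩ N)`.
[cite: Casselman1995, Prop. 1.4.4] [cite: BruhatTits1972, (4.4.3)–(4.4.4)] -/
theorem existsUnique_iwahori_level {δ : ValueGroupWithZero K} (hδ : δ < 1) {k : ↥(unitaryGroupOfForm σ J)}
    (hk : k ∈ (congruenceGL N δ).comap (unitaryGroupOfForm σ J).subtype) :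
    ∃! p : ↥(unitaryGroupOfForm σ J) × (↥(unitaryGroupOfForm σ J) × ↥(unitaryGroupOfForm σ J)),
      (p.1 ∈ (congruenceGL N δ).comap (unitaryGroupOfForm σ J).subtype ⊓ ((borelTriple σ J hJ).N).map (MulAut.conj (weylLongU σ hJ)).toMonoidHom ∧
        p.2.1 ∈ (congruenceGL N δ).comap (unitaryGroupOfForm σ J).subtype ⊓ (borelTriple σ J hJ).M ∧
        p.2.2 ∈ (congruenceGL N δ).comap (unitaryGroupOfForm σ J).subtype ⊓ (borelTriple σ J hJ).N) ∧
      k = p.1 * p.2.1 * p.2.2 := by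
  obtain ⟨p, ⟨hp1, hp2, hp3⟩, hpk⟩ := (bijOn_iwahori_level σ hJ hδ).surjOn hk
  refine ⟨p, ⟨⟨hp1, hp2, hp3⟩, hpk.symm⟩, fun q ⟨⟨hq1, hq2, hq3⟩, hqk⟩ => ?_⟩
  exact (bijOn_iwahori_level σ hJ hδ).injOn ⟨hq1, hq2, hq3⟩ ⟨hp1, hp2, hp3⟩ (hqk.symm.trans hpk.symm)

/-- **Each piece of an `N̄ · T · N` product that lands in `K_δ` lies in `K_δ`** (`δ < 1`, any rank): if `n̄ m n ∈ K_δ` with `n̄ ∈ w₀Nw₀`, `m ∈ T`, `n ∈ N`, then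
`n̄, m, n ∈ K_δ`. [cite: Casselman1995, Prop. 1.4.4] -/
theorem mem_level_of_nbar_torus_unipotent_mem {δ : ValueGroupWithZero K} (hδ : δ < 1) {nb m n : ↥(unitaryGroupOfForm σ J)}
    (hnb : nb ∈ ((borelTriple σ J hJ).N).map (MulAut.conj (weylLongU σ hJ)).toMonoidHom) (hm : m ∈ (borelTriple σ J hJ).M)
    (hn : n ∈ (borelTriple σ J hJ).N) (hk : nb * m * n ∈ (congruenceGL N δ).comap (unitaryGroupOfForm σ J).subtype) :
    nb ∈ (congruenceGL N δ).comap (unitaryGroupOfForm σ J).subtype ∧ m ∈ (congruenceGL N δ).comap (unitaryGroupOfForm σ J).subtype ∧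
      n ∈ (congruenceGL N δ).comap (unitaryGroupOfForm σ J).subtype := by
  obtain ⟨⟨x, y, z⟩, ⟨hx, hy, hz⟩, hxyz⟩ := (bijOn_iwahori_level σ hJ hδ).surjOn hk
  have hmem : ((x, y, z) : ↥(unitaryGroupOfForm σ J) × (↥(unitaryGroupOfForm σ J) × ↥(unitaryGroupOfForm σ J))) ∈
      (((((borelTriple σ J hJ).N).map (MulAut.conj (weylLongU σ hJ)).toMonoidHom : Subgroup ↥(unitaryGroupOfForm σ J)) : Set ↥(unitaryGroupOfForm σ J)) ×ˢ
        ((((borelTriple σ J hJ).M : Subgroup ↥(unitaryGroupOfForm σ J)) : Set ↥(unitaryGroupOfForm σ J)) ×ˢ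
          (((borelTriple σ J hJ).N : Subgroup ↥(unitaryGroupOfForm σ J)) : Set ↥(unitaryGroupOfForm σ J)))) :=
    ⟨(Subgroup.mem_inf.1 hx).2, (Subgroup.mem_inf.1 hy).2, (Subgroup.mem_inf.1 hz).2⟩
  have hmem' : ((nb, m, n) : ↥(unitaryGroupOfForm σ J) × (↥(unitaryGroupOfForm σ J) × ↥(unitaryGroupOfForm σ J))) ∈
      (((((borelTriple σ J hJ).N).map (MulAut.conj (weylLongU σ hJ)).toMonoidHom : Subgroup ↥(unitaryGroupOfForm σ J)) : Set ↥(unitaryGroupOfForm σ J)) ×ˢ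
        ((((borelTriple σ J hJ).M : Subgroup ↥(unitaryGroupOfForm σ J)) : Set ↥(unitaryGroupOfForm σ J)) ×ˢ
          (((borelTriple σ J hJ).N : Subgroup ↥(unitaryGroupOfForm σ J)) : Set ↥(unitaryGroupOfForm σ J)))) := ⟨hnb, hm, hn⟩
  have heq : ((x, y, z) : ↥(unitaryGroupOfForm σ J) × (↥(unitaryGroupOfForm σ J) × ↥(unitaryGroupOfForm σ J))) = (nb, m, n) :=
    injOn_nbar_torus_unipotent σ hJ hmem hmem' hxyz
  simp only [Prod.mk.injEq] at heq
  obtain ⟨h1, h2, h3⟩ := heq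
  subst h1; subst h2; subst h3
  exact ⟨(Subgroup.mem_inf.1 hx).1, (Subgroup.mem_inf.1 hy).1, (Subgroup.mem_inf.1 hz).1⟩

end AnyRank
/-! ## §2 Rank 2: the levels of `N₂` in the line chart `u ↦ u₀₁`, and the line boxes -/
section LineLevel
variable {K : Type*} [Field K] [ValuativeRel K] (σ : K →+* K) {J : Matrix (Fin 2) (Fin 2) K}

/-- A `2 × 2` matrix whose four entries have valuation `≤ γ` satisfies `ValBound γ`. [cite: Casselman1995, Prop. 1.4.4] -/
theorem valBound_of_fin_two {γ : ValueGroupWithZero K} {M : Matrix (Fin 2) (Fin 2) K} (h00 : valuation K (M 0 0) ≤ γ) (h01 : valuation K (M 0 1) ≤ γ)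
    (h10 : valuation K (M 1 0) ≤ γ) (h11 : valuation K (M 1 1) ≤ γ) : ValBound γ M := by
  intro i j
  fin_cases i <;> fin_cases j
  exacts [h00, h01, h10, h11]

/-- **(L1)₂ `K_δ ∩ N₂` IS THE LINE BOX OF RADIUS `δ`.**  For a level `δ < 1` and `u ∈ N₂ ≤ U(σ, J)(K)` (`2 × 2`): `u ∈ K_δ ↔ v(u₀₁) ≤ δ` (the only off-diagonal entry of `u − 1` is
`u₀₁`, that of `u⁻¹ − 1` is `−u₀₁` ★ `LineRing.umat_inv_zero_one_two`; no `v(½)` side condition, `N₂` having no Heisenberg coordinate).  The form `J` is arbitrary here (only the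
shape of `N = U ∩ (upper unitriangular)` is used). [cite: Casselman1995, Prop. 1.4.4] [cite: Rogawski1990, §1.10 p. 9] -/
theorem mem_level_iff_of_mem_unipotentU_two {δ : ValueGroupWithZero K} (hδ : δ < 1) (u : ↥(unipotentU σ J)) :
    (u : ↥(unitaryGroupOfForm σ J)) ∈ (congruenceGL 2 δ).comap (unitaryGroupOfForm σ J).subtype ↔
      valuation K ((((u : ↥(unitaryGroupOfForm σ J)) : GL (Fin 2) K) : Matrix (Fin 2) (Fin 2) K) 0 1) ≤ δ := by
  rw [Subgroup.mem_comap, Subgroup.coe_subtype, mem_congruenceGL_iff]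
  obtain ⟨h10, h00, h11⟩ := umat_shape_two σ u
  obtain ⟨hi10, hi00, hi11⟩ := umat_shape_two σ u⁻¹
  have hi01 := umat_inv_zero_one_two σ u
  -- the inverse in `GL₂` is the coercion of the inverse in `N₂`
  have hinv : (((u : ↥(unitaryGroupOfForm σ J)) : GL (Fin 2) K)⁻¹ : GL (Fin 2) K) = (((u⁻¹ : ↥(unipotentU σ J)) : ↥(unitaryGroupOfForm σ J)) : GL (Fin 2) K) := rfl
  constructor
  · rintro ⟨-, h1, -⟩
    have h := h1 0 1
    rwa [Matrix.sub_apply, Matrix.one_apply_ne (by decide), sub_zero] at h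
  · intro hy
    have hδ1 : δ ≤ 1 := hδ.le
    have hz : ∀ γ : ValueGroupWithZero K, valuation K (0 : K) ≤ γ := fun γ => by rw [map_zero]; exact zero_le
    have h1 : ∀ γ : ValueGroupWithZero K, valuation K ((1 : K) - 1) ≤ γ := fun γ => by rw [sub_self]; exact hz γ
    refine ⟨⟨valBound_of_fin_two ?_ ?_ ?_ ?_, valBound_of_fin_two ?_ ?_ ?_ ?_⟩, valBound_of_fin_two ?_ ?_ ?_ ?_, valBound_of_fin_two ?_ ?_ ?_ ?_⟩
    · rw [h00, map_one]
    · exact hy.trans hδ1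
    · rw [h10]; exact hz 1
    · rw [h11, map_one]
    · rw [hinv, hi00, map_one]
    · rw [hinv, hi01, Valuation.map_neg]; exact hy.trans hδ1
    · rw [hinv, hi10]; exact hz 1
    · rw [hinv, hi11, map_one]
    · rw [Matrix.sub_apply, h00, Matrix.one_apply_eq]; exact h1 δ
    · rw [Matrix.sub_apply, Matrix.one_apply_ne (by decide), sub_zero]; exact hy
    · rw [Matrix.sub_apply, h10, Matrix.one_apply_ne (by decide), sub_zero]; exact hz δ
    · rw [Matrix.sub_apply, h11, Matrix.one_apply_eq]; exact h1 δ
    · rw [hinv, Matrix.sub_apply, hi00, Matrix.one_apply_eq]; exact h1 δ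
    · rw [hinv, Matrix.sub_apply, Matrix.one_apply_ne (by decide), sub_zero, hi01, Valuation.map_neg]; exact hy
    · rw [hinv, Matrix.sub_apply, hi10, Matrix.one_apply_ne (by decide), sub_zero]; exact hz δ
    · rw [hinv, Matrix.sub_apply, hi11, Matrix.one_apply_eq]; exact h1 δ

end LineLevel
section LineBox

variable {R : Type*} [CommRing R] (σ : R →+* R) {J : Matrix (Fin 2) (Fin 2) R}
  {Γ₀ : Type*} [LinearOrderedCommGroupWithZero Γ₀] (v : Valuation R Γ₀)

/-- **(L6)₂ THE LINE BOX `{u ∣ v(u₀₁) ≤ ρ}` IS A SUBGROUP of `N₂`** for EVERY radius `ρ` (the chart `u ↦ u₀₁` is additive ★ `umat_mul_zero_one_two`, `(u⁻¹)₀₁ = −u₀₁`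
★ `umat_inv_zero_one_two`; ultrametric inequality) — over any commutative ring with a valuation, stated as an existence so that no definition is introduced (★ (J2) §4 pattern).
[cite: vanDijk1972, §2] [cite: Rogawski1990, §1.10 p. 9] -/
theorem exists_subgroup_lineBox (ρ : Γ₀) :
    ∃ H : Subgroup ↥(unipotentU σ J), ∀ u : ↥(unipotentU σ J),
      u ∈ H ↔ v ((((u : ↥(unitaryGroupOfForm σ J)) : GL (Fin 2) R) : Matrix (Fin 2) (Fin 2) R) 0 1) ≤ ρ := by
  refine ⟨{ carrier := {u | v ((((u : ↥(unitaryGroupOfForm σ J)) : GL (Fin 2) R) : Matrix (Fin 2) (Fin 2) R) 0 1) ≤ ρ}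
            mul_mem' := ?_, one_mem' := ?_, inv_mem' := ?_ }, fun u => Iff.rfl⟩
  · intro u w hu hw
    simp only [Set.mem_setOf_eq] at hu hw ⊢
    rw [umat_mul_zero_one_two]
    exact le_trans (Valuation.map_add _ _ _) (max_le hu hw)
  · simp only [Set.mem_setOf_eq]
    rw [OneMemClass.coe_one, OneMemClass.coe_one, Units.val_one, Matrix.one_apply_ne (by decide), Valuation.map_zero]
    exact zero_le
  · intro u hu
    simp only [Set.mem_setOf_eq] at hu ⊢
    rw [umat_inv_zero_one_two, Valuation.map_neg]
    exact hu

end LineBox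


/-! ## §3 The line boxes and the level pieces as `Subgroup`s of the ambient `U′` with their carriers (the shape the sandwich ∕ index bricks consume) -/

section BoxSubgroups

variable {R : Type*} [CommRing R] (σ : R →+* R) {J : Matrix (Fin 2) (Fin 2) R}
  {Γ₀ : Type*} [LinearOrderedCommGroupWithZero Γ₀] (v : Valuation R Γ₀)

/-- **The line box `N[ρ]` as a `Subgroup` of `U′ = U(σ, J)(R)`** (`2 × 2`, every radius): there is `S ≤ N₂` with carrier `(↑) '' {u ∈ N₂ ∣ v(u₀₁) ≤ ρ}` — the `Subgroup.map` of
(L6)₂'s box subgroup along `N₂ ↪ U′` (★ (J2)-sequel `exists_subgroup_coe_eq_image_box` one rank down, with no radius condition). [cite: vanDijk1972, §2] [cite: Rogawski1990, §1.10 p. 9] -/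
theorem exists_subgroup_coe_eq_image_lineBox (ρ : Γ₀) :
    ∃ S : Subgroup ↥(unitaryGroupOfForm σ J), S ≤ unipotentU σ J ∧
      (S : Set ↥(unitaryGroupOfForm σ J)) =
        (fun u : ↥(unipotentU σ J) => (u : ↥(unitaryGroupOfForm σ J))) ''
          {u | v ((((u : ↥(unitaryGroupOfForm σ J)) : GL (Fin 2) R) : Matrix (Fin 2) (Fin 2) R) 0 1) ≤ ρ} := by
  obtain ⟨H, hH⟩ := exists_subgroup_lineBox σ v ρ
  refine ⟨H.map (unipotentU σ J).subtype, ?_, ?_⟩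
  · intro x hx
    obtain ⟨n, -, rfl⟩ := Subgroup.mem_map.1 hx
    exact n.2
  · ext x
    simp only [Subgroup.coe_map, Subgroup.coe_subtype, Set.mem_image, SetLike.mem_coe, Set.mem_setOf_eq, hH]

end BoxSubgroups
section ConjBox

variable {K : Type*} [Field K] (σ : K →+* K) {J : Matrix (Fin 2) (Fin 2) K} (hJ : J = (StdForm.antidiagonal 2).over K)
  {Γ₀ : Type*} [LinearOrderedCommGroupWithZero Γ₀] (v : Valuation K Γ₀)

/-- **The opposite line box `N̄[ρ] = w₀ N[ρ] w₀` as a `Subgroup` of `U′`** (`J = Φ₂`): the `Subgroup.map` of the line-box subgroup along `conj w₀`, with carrier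
`{w₀ ↑u w₀⁻¹ ∣ u ∈ N₂, v(u₀₁) ≤ ρ}` and `≤ N̄ = N.map (conj w₀)`. [cite: Casselman1995, Prop. 1.4.4] [cite: Rogawski1990, §1.10 p. 9] -/
theorem exists_subgroup_coe_eq_image_conj_lineBox (ρ : Γ₀) :
    ∃ S : Subgroup ↥(unitaryGroupOfForm σ J), S ≤ ((borelTriple σ J hJ).N).map (MulAut.conj (weylLongU σ hJ)).toMonoidHom ∧
      (S : Set ↥(unitaryGroupOfForm σ J)) =
        (fun u : ↥(unipotentU σ J) => weylLongU σ hJ * (u : ↥(unitaryGroupOfForm σ J)) * (weylLongU σ hJ)⁻¹) ''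
          {u | v ((((u : ↥(unitaryGroupOfForm σ J)) : GL (Fin 2) K) : Matrix (Fin 2) (Fin 2) K) 0 1) ≤ ρ} := by
  obtain ⟨S, hSN, hS⟩ := exists_subgroup_coe_eq_image_lineBox σ v (J := J) ρ
  refine ⟨S.map (MulAut.conj (weylLongU σ hJ)).toMonoidHom, ?_, ?_⟩
  · rw [borelTriple_N]
    exact Subgroup.map_mono hSN
  · rw [Subgroup.coe_map, hS, Set.image_image]
    rfl

end ConjBox
section LevelPieces
variable {K : Type*} [Field K] [ValuativeRel K] (σ : K →+* K)

/-- **`K_δ ∩ N₂` IS the image of the line box of radius `δ`** (`δ < 1`; (L1)₂): `↑(K_δ ⊓ N) = (↑) '' {u ∈ N₂ ∣ v(u₀₁) ≤ δ}`. [cite: Casselman1995, Prop. 1.4.4] -/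
theorem coe_level_inf_unipotent_eq_image_lineBox {J : Matrix (Fin 2) (Fin 2) K} (hJ : J = (StdForm.antidiagonal 2).over K)
    {δ : ValueGroupWithZero K} (hδ : δ < 1) :
    (((congruenceGL 2 δ).comap (unitaryGroupOfForm σ J).subtype ⊓ (borelTriple σ J hJ).N : Subgroup ↥(unitaryGroupOfForm σ J)) :
        Set ↥(unitaryGroupOfForm σ J)) =
      (fun u : ↥(unipotentU σ J) => (u : ↥(unitaryGroupOfForm σ J))) ''
        {u | valuation K ((((u : ↥(unitaryGroupOfForm σ J)) : GL (Fin 2) K) : Matrix (Fin 2) (Fin 2) K) 0 1) ≤ δ} := by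
  ext x
  rw [SetLike.mem_coe, Subgroup.mem_inf, borelTriple_N, Set.mem_image]
  constructor
  · rintro ⟨hxK, hxN⟩
    exact ⟨⟨x, hxN⟩, (mem_level_iff_of_mem_unipotentU_two σ hδ ⟨x, hxN⟩).1 hxK, rfl⟩
  · rintro ⟨u, hu, rfl⟩
    exact ⟨(mem_level_iff_of_mem_unipotentU_two σ hδ u).2 hu, u.2⟩

/-- **`K_δ ∩ N₂` as an abstract box-subgroup** in the shape `∃ S ≤ N, ↑S = (↑) '' N₂[δ]`. [cite: Casselman1995, Prop. 1.4.4] -/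
theorem exists_subgroup_coe_eq_unipotent_lineBox {J : Matrix (Fin 2) (Fin 2) K} (hJ : J = (StdForm.antidiagonal 2).over K)
    {δ : ValueGroupWithZero K} (hδ : δ < 1) :
    ∃ S : Subgroup ↥(unitaryGroupOfForm σ J), S ≤ (borelTriple σ J hJ).N ∧
      (S : Set ↥(unitaryGroupOfForm σ J)) =
        (fun u : ↥(unipotentU σ J) => (u : ↥(unitaryGroupOfForm σ J))) ''
          {u | valuation K ((((u : ↥(unitaryGroupOfForm σ J)) : GL (Fin 2) K) : Matrix (Fin 2) (Fin 2) K) 0 1) ≤ δ} :=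
  ⟨(congruenceGL 2 δ).comap (unitaryGroupOfForm σ J).subtype ⊓ (borelTriple σ J hJ).N, inf_le_right, coe_level_inf_unipotent_eq_image_lineBox σ hJ hδ⟩

variable {N : ℕ} {J : Matrix (Fin N) (Fin N) K} (hJ : J = (StdForm.antidiagonal N).over K)

/-- **`K_δ ∩ T` IS the diagonal box** (`δ < 1`, any rank; (L3)): `↑(K_δ ⊓ T) = {x ∣ ∃ d, diag(d) = x ∧ ∀ i, v(dᵢ − 1) ≤ δ}`. [cite: Casselman1995, Prop. 1.4.4] -/
theorem coe_level_inf_torus_eq {δ : ValueGroupWithZero K} (hδ : δ < 1) :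
    (((congruenceGL N δ).comap (unitaryGroupOfForm σ J).subtype ⊓ (borelTriple σ J hJ).M : Subgroup ↥(unitaryGroupOfForm σ J)) :
        Set ↥(unitaryGroupOfForm σ J)) =
      {x : ↥(unitaryGroupOfForm σ J) | ∃ d : Fin N → Kˣ, glDiagonal N K d = (x : GL (Fin N) K) ∧ ∀ i, valuation K ((d i : K) - 1) ≤ δ} := by
  ext x
  rw [SetLike.mem_coe, Subgroup.mem_inf, borelTriple_M, mem_torusU_iff, Set.mem_setOf_eq]
  constructor
  · rintro ⟨hxK, ⟨d, hd⟩⟩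
    exact ⟨d, hd, (mem_level_iff_of_eq_glDiagonal σ hδ hd).1 hxK⟩
  · rintro ⟨d, hd, h⟩
    exact ⟨(mem_level_iff_of_eq_glDiagonal σ hδ hd).2 h, ⟨d, hd⟩⟩

/-- **`K_δ ∩ T` as an abstract box-subgroup** (any rank) in the shape `∃ S ≤ T, ↑S = {…}`. [cite: Casselman1995, Prop. 1.4.4] -/
theorem exists_subgroup_coe_eq_torus_box {δ : ValueGroupWithZero K} (hδ : δ < 1) :
    ∃ S : Subgroup ↥(unitaryGroupOfForm σ J), S ≤ (borelTriple σ J hJ).M ∧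
      (S : Set ↥(unitaryGroupOfForm σ J)) =
        {x : ↥(unitaryGroupOfForm σ J) | ∃ d : Fin N → Kˣ, glDiagonal N K d = (x : GL (Fin N) K) ∧ ∀ i, valuation K ((d i : K) - 1) ≤ δ} :=
  ⟨(congruenceGL N δ).comap (unitaryGroupOfForm σ J).subtype ⊓ (borelTriple σ J hJ).M, inf_le_right, coe_level_inf_torus_eq σ hJ hδ⟩

end LevelPieces

end Summit.HodgeConjecture.HodgeConjecture.Cruxes.H413.F0P3cStCharTSUpTrU2Levels

end
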